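import Mathlib
import Summits.QuantumFields.YangMills.Theorems.ComplexCouplingChannelContinuumLegGivenGapStubBumpPairPositivityDict
import HarnessLib

/-!
# `ContinuumLegGivenGap` — line `duality-selection-nlo-skewness`, stub `stub_bumpPairPositivity`

Stub file for crux `stmt-QuantumFields-15828` (`ComplexCouplingChannel.ContinuumLegGivenGap`, shared by seven
routes), Källén–Lehmann programme (blueprint item (P1)): **reflection positivity of bump pairs and the Laplace
dichotomy** for OS data. The whole proof is the dictionary file
`ComplexCouplingChannelContinuumLegGivenGapStubBumpPairPositivityDict` (`BumpPair.positivity_dichotomy`: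
E1/E3 covariance reduces every separated pair to the axis pair, whose truncated value is
`‖Ψ − ⟨Ω,Ψ⟩Ω‖²` in the E1-free OS reconstruction, and `e^{−uH}` propagates one zero of it to all
separations via `OSReconstructionNoE1.eq_zero_of_inner_transfer_eq_zero`). [folklore]
-/

noncomputable section

namespace Summit.QuantumFields.YangMills.Cruxes.ContinuumLegGivenGap.DualitySelectionNloSkewness

open scoped SchwartzMap InnerProductSpace ComplexOrder
open Filter Topology MeasureTheory Literature.MathematicalPhysics.QuantumFieldTheory
  Literature.MathematicalPhysics.QuantumLattice Literature.MathematicalPhysics.AQFT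

/-- `stub_bumpPairPositivity` — **reflection positivity of bump pairs and the Laplace dichotomy.** For OS data `T`,
a species `s`, a real non-negative RADIAL bump `φ` supported in `closedBall 0 r` and the truncated two-point value
`W(a,b) = 𝔖₂(φ_a ⊗ φ_b) − 𝔖₁(φ_a)𝔖₁(φ_b)` of its translates (`φ_a = φ(· − a)`; `W` is quantified with its
defining equation as a hypothesis, a `:=`-free rendering of the skeleton's `let`): for `dist a b > 2r`
(i) `W(a,b) ≥ 0` (real); (ii) `W(a,b)` depends only on `dist a b` (E1 translations + proper rotations — supplied as a
hypothesis for `d ≥ 2` — and E3 symmetry); (iii) if `Re W` vanishes at ONE separated pair it vanishes at all of them.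
Mechanism: at the axis pair `a = −(t/2)e₀, b = (t/2)e₀` radiality gives `φ_a = Θ(φ_b)*`, so by E2 (list `(1, φ_b)`)
`W = ‖P_Ω^⊥ Ψ_{φ_b}‖²` in the E1-free OS reconstruction, and `t ↦ W` is `‖e^{-uH/2}ψ‖²`, which vanishes at one `u`
iff `ψ = 0` (`OSReconstructionNoE1.eq_zero_of_inner_transfer_eq_zero`). [folklore] -/
theorem stub_bumpPairPositivity :
    (∀ (ι : Type) (d : ℕ) [NeZero d] (T : OSData ι d) (s : ι)
      (φ : 𝓢(EuclideanSpace ℝ (Fin d), ℂ)) (r : ℝ), 0 < r →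
      (∀ x, (φ x).im = 0 ∧ 0 ≤ (φ x).re) →
      (∀ (L : EuclideanSpace ℝ (Fin d) ≃ₗᵢ[ℝ] EuclideanSpace ℝ (Fin d)) (x : EuclideanSpace ℝ (Fin d)), φ (L x) = φ x) →
      tsupport (φ : EuclideanSpace ℝ (Fin d) → ℂ) ⊆ Metric.closedBall 0 r →
      (2 ≤ d → ∀ u v : EuclideanSpace ℝ (Fin d), ‖u‖ = ‖v‖ →
        ∃ R : EuclideanSpace ℝ (Fin d) ≃ₗᵢ[ℝ] EuclideanSpace ℝ (Fin d),
          LinearMap.det (R.toLinearEquiv : EuclideanSpace ℝ (Fin d) →ₗ[ℝ] EuclideanSpace ℝ (Fin d)) = 1 ∧ R u = v) →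
      ∀ W : EuclideanSpace ℝ (Fin d) → EuclideanSpace ℝ (Fin d) → ℂ,
      (∀ a b, W a b =
        T.schwinger 2 (fun _ => s) (SchwartzMap.tensorFin 2
            ![SchwartzMap.compSubConstCLM ℂ a φ, SchwartzMap.compSubConstCLM ℂ b φ]) -
          T.schwinger 1 (fun _ => s) (SchwartzMap.tensorFin 1 ![SchwartzMap.compSubConstCLM ℂ a φ]) *
            T.schwinger 1 (fun _ => s) (SchwartzMap.tensorFin 1 ![SchwartzMap.compSubConstCLM ℂ b φ])) →
      (∀ a b : EuclideanSpace ℝ (Fin d), 2 * r < dist a b → 0 ≤ (W a b).re ∧ (W a b).im = 0) ∧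
      (∀ a b a' b' : EuclideanSpace ℝ (Fin d), 2 * r < dist a b → dist a b = dist a' b' → W a b = W a' b') ∧
      ((∃ a b : EuclideanSpace ℝ (Fin d), 2 * r < dist a b ∧ (W a b).re = 0) →
        ∀ a b : EuclideanSpace ℝ (Fin d), 2 * r < dist a b → (W a b).re = 0)) := by
  intro ι d _ T s φ r hr hφ hrad hsupp hrot W hW
  obtain rfl : W = _ := funext fun a => funext fun b => hW a b
  exact BumpPair.positivity_dichotomy ι d T s φ r hr hφ hrad hsupp hrot

end Summit.QuantumFields.YangMills.Cruxes.ContinuumLegGivenGap.DualitySelectionNloSkewness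

end
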